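import Mathlib
import Summits.Ventures.FusionMHD.Models.SolovevPCF
import HarnessLib

/-!
# Ventures/FusionMHD — Models/SolovevPCFManufactured.lean: the MANUFACTURED SEMILINEAR CONTROL of the F2 ladder
# (F2-SCOPING §3 rung F2.A-1): a genuinely nonlinear Grad–Shafranov-type boundary-value problem whose exact solution is
# the analytic PCF Solov'ev `Ψ` of record

HONEST FRAMING (LADDER-GRIDFUSION three columns). MODELLED — and NOT an equilibrium: the method of manufactured
solutions. For a nonlinearity parameter `λ` the problem is
`Δ*u = R²(1 + λu²) + s_λ(R, Z)` in `Ω = {Ψ < 0, R > 0}`, `u = 0` on `∂Ω = {Ψ = 0}`,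
with the EXPLICIT polynomial source `s_λ := −λR²Ψ²`, where `Ψ = psiPCF d₁ d₂ d₃` is the pure-polynomial
Pataki–Cerfon–Freidberg solution of `Δ*Ψ = R²` (`Models/SolovevPCF.lean`). By construction `u = Ψ` solves it
exactly (for EVERY `λ`), so a validated-numerics enclosure of this semilinear problem (gridfusion F2 step «2b»
family, certnum route A) can be tested against the SAME planted truth as step 2a — the nonlinearity
`R²λu²` is the only new ingredient. Without the source the right-hand side is the Grad–Shafranov right-hand
side (6.15) of a CUBIC pressure profile `μ₀p(u) = −(u + λu³/3)` with constant `F` (`gsRHS_cubicPressure`),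
i.e. `μ₀p′ = −(1 + λu²)`; the source term is what makes the truth exact and is why this is a NUMERICS
CONTROL, not a model of any plasma. Uniqueness remark (not used in the kernel): for `λ ≤ 0` the linearisation
at the truth, `Δ*v = 2λR²Ψ·v`, is injective under Dirichlet conditions by the energy identity
`−∫|∇v|²/R = 2λ∫RΨv² ≥ 0` (`Ψ < 0` in `Ω`), so `λ < 0` is the recommended sign; `|λ|Ψ_axis² ≈ 1.5·10⁻³|λ|`
sets the relative size of the nonlinearity (`λ = −100` ⇒ ≈ 15 %). CERTIFIED content (kernel, this file): the
exact identities below; no enclosure, no stability word. Typer/prover: gridfusion-model-5 (g4), 2026-08-27.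
Citations: Pataki–Cerfon–Freidberg 2013 §6.1 [PatakiCerfonFreidberg2013]; Freidberg 2014 (6.15), (6.149)
[Freidberg2014].
-/

noncomputable section

namespace Summit.Ventures.FusionMHD.Models.SolovevPCF

open Literature.MathematicalPhysics.MHD Literature.MathematicalPhysics.MHD.GradShafranov
  Literature.MathematicalPhysics.MHD.Solovev _root_.Real

/-- The manufactured source `s_λ(R, Z) = −λR²Ψ(R, Z)²` for the truth `Ψ = psiPCF d₁ d₂ d₃` (an explicit
polynomial in `(R, Z)` of degree 10). MODELLED: numerics control, not a plasma source. -/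
def manufacturedSource (lam d₁ d₂ d₃ : ℝ) (R Z : ℝ) : ℝ := -(lam * R ^ 2 * psiPCF d₁ d₂ d₃ R Z ^ 2)

/-- The semilinear problem of rung F2.A-1 on a region `Ω`: `Δ*u = R²(1 + λu²) + s(R, Z)` pointwise on `Ω`
(the Dirichlet condition `u = 0` on `{Ψ = 0}` is stated separately by the consumer; regularity is the user's
hypothesis, as for `IsGSSolutionOn`). MODELLED: numerics control (the method of manufactured solutions). [folklore] -/
def IsManufacturedSolutionOn (Ω : Set (ℝ × ℝ)) (lam : ℝ) (s u : ℝ → ℝ → ℝ) : Prop :=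
  ∀ R Z, (R, Z) ∈ Ω → gsOperator u R Z = R ^ 2 * (1 + lam * u R Z ^ 2) + s R Z

/-- **The truth is exact for every `λ`:** `Ψ = psiPCF d₁ d₂ d₃` solves `Δ*u = R²(1 + λu²) − λR²Ψ²` on
`{R ≠ 0}` (because `Δ*Ψ = R²`, `gsOperator_psiPCF`). -/
theorem psiPCF_isManufacturedSolution (lam d₁ d₂ d₃ : ℝ) :
    IsManufacturedSolutionOn {x : ℝ × ℝ | x.1 ≠ 0} lam (manufacturedSource lam d₁ d₂ d₃) (psiPCF d₁ d₂ d₃) := by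
  intro R Z hR
  rw [gsOperator_psiPCF d₁ d₂ d₃ Z hR]
  unfold manufacturedSource
  ring

/-- Without the source, the right-hand side `R²(1 + λu²)` IS the Grad–Shafranov right-hand side (6.15) of
the cubic pressure profile `p(u) = −(u + λu³/3)/μ₀` with a constant free function `F ≡ g`:
`gsRHS μ₀ p F R u = −μ₀R²p′(u) − ½(F²)′ = R²(1 + λu²)` (`μ₀ ≠ 0`). -/
theorem gsRHS_cubicPressure {μ0 : ℝ} (hμ : μ0 ≠ 0) (lam g R u : ℝ) :
    gsRHS μ0 (fun s => -(s + lam * s ^ 3 / 3) / μ0) (fun _ => g) R u = R ^ 2 * (1 + lam * u ^ 2) := by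
  unfold gsRHS
  have hp : deriv (fun s => -(s + lam * s ^ 3 / 3) / μ0) u = -(1 + lam * u ^ 2) / μ0 := by
    have h3 : HasDerivAt (fun s : ℝ => s ^ 3) (3 * u ^ 2) u := by
      simpa using hasDerivAt_pow 3 u
    have h1 := ((hasDerivAt_id' u).add ((h3.const_mul lam).div_const 3)).neg.div_const μ0
    exact (h1.congr_deriv (by ring)).deriv
  have hF : deriv (fun _ : ℝ => g ^ 2) u = 0 := deriv_const u _
  rw [hp, hF]
  field_simp
  ring

/-- Hence, pointwise, the manufactured equation is «Grad–Shafranov with cubic pressure, constant `F`, plus the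
explicit source»: `Δ*u = gsRHS μ₀ p F R (u R Z) + s(R, Z)` on `Ω`. -/
theorem isManufacturedSolutionOn_iff_gsRHS {μ0 : ℝ} (hμ : μ0 ≠ 0) (Ω : Set (ℝ × ℝ)) (lam g : ℝ)
    (s u : ℝ → ℝ → ℝ) :
    IsManufacturedSolutionOn Ω lam s u ↔
      ∀ R Z, (R, Z) ∈ Ω →
        gsOperator u R Z = gsRHS μ0 (fun t => -(t + lam * t ^ 3 / 3) / μ0) (fun _ => g) R (u R Z) + s R Z := by
  unfold IsManufacturedSolutionOn
  constructor
  · intro h R Z hRZ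
    rw [h R Z hRZ, gsRHS_cubicPressure hμ]
  · intro h R Z hRZ
    rw [h R Z hRZ, gsRHS_cubicPressure hμ]

namespace IterLike

/-- The manufactured source of the ITER-like instance: `s_λ = −λR²·psi²`. MODELLED: numerics control. -/
def manufacturedSource (lam : ℝ) : ℝ → ℝ → ℝ := SolovevPCF.manufacturedSource lam d₁ d₂ d₃

/-- The ITER-like `psi` solves the manufactured semilinear problem on `{R ≠ 0}` (hence on its plasma region
`{psi < 0, R > 0}`) for every `λ`, and vanishes on its boundary `{psi = 0}` tautologically. -/
theorem psi_isManufacturedSolution (lam : ℝ) :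
    IsManufacturedSolutionOn {x : ℝ × ℝ | x.1 ≠ 0} lam (manufacturedSource lam) psi :=
  psiPCF_isManufacturedSolution lam d₁ d₂ d₃

/-- Restriction to the plasma region `{psi < 0} ∩ {R > 0}`. -/
theorem psi_isManufacturedSolution_plasma (lam : ℝ) :
    IsManufacturedSolutionOn {x : ℝ × ℝ | psi x.1 x.2 < 0 ∧ 0 < x.1} lam (manufacturedSource lam) psi :=
  fun R Z h => psi_isManufacturedSolution lam R Z (ne_of_gt h.2)

end IterLike

namespace NstxLike

/-- The manufactured source of the NSTX-like instance: `s_λ = −λR²·psi²`. MODELLED: numerics control. -/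
def manufacturedSource (lam : ℝ) : ℝ → ℝ → ℝ := SolovevPCF.manufacturedSource lam d₁ d₂ d₃

/-- The NSTX-like `psi` solves the manufactured semilinear problem on `{R ≠ 0}` for every `λ`. -/
theorem psi_isManufacturedSolution (lam : ℝ) :
    IsManufacturedSolutionOn {x : ℝ × ℝ | x.1 ≠ 0} lam (manufacturedSource lam) psi :=
  psiPCF_isManufacturedSolution lam d₁ d₂ d₃

/-- Restriction to the plasma region `{psi < 0} ∩ {R > 0}`. -/
theorem psi_isManufacturedSolution_plasma (lam : ℝ) :
    IsManufacturedSolutionOn {x : ℝ × ℝ | psi x.1 x.2 < 0 ∧ 0 < x.1} lam (manufacturedSource lam) psi :=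
  fun R Z h => psi_isManufacturedSolution lam R Z (ne_of_gt h.2)

end NstxLike

end Summit.Ventures.FusionMHD.Models.SolovevPCF
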